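import Literature.Probability.RandomPlanarGeometry.HexSAWRotStripMonotone
import Literature.Probability.RandomPlanarGeometry.HexSAWRotStripClasses
import HarnessLib

/-!
# Beaton's rotated strip: the width limit `B_T(x_c) = lim_{W → ∞} B^{⊥,→}_{H,W}(x_c)` exists and is `≤ x_c`

Topic `Literature/Probability/RandomPlanarGeometry` (continues `HexSAWRotStripMonotone.lean` — `HV.rotStripBR_mono_width`,
the partition function `B^{⊥,→}_{H,W}` is increasing in the width — and `HexSAWRotStripClasses.lean` —
`HV.rotStripBR_le_hexCriticalFugacity`, the bound `B^{⊥,→}_{H,W} ≤ x_c` from the rotated-strip identity K95.1).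
Source: N. R. Beaton, J. Phys. A 47 (2014) 075003 (arXiv:1210.0274), §4: "the `B_{T,L}(x_c)` are increasing in `L` and
bounded (by the identity), so they all have limits `B_T(x_c)`" — monotone + bounded ⇒ convergent (`tendsto_atTop_ciSup`).

## Contents (namespace `Literature.Probability.RandomPlanarGeometry.SAW.HV`, all PROVED)

* `rotStripBR_monotone` — `W ↦ B^{⊥,→}_{H,W}` is monotone;
* `rotStripBR_le_xc_all` — `B^{⊥,→}_{H,W} ≤ x_c` for every `W` (incl. `W = 0`) once `H ≥ 1`;
* `rotStripBR_bddAbove`, **`tendsto_rotStripBR`** — `B^{⊥,→}_{H,W} → ⨆_W B^{⊥,→}_{H,W}` as `W → ∞`;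
* `iSup_rotStripBR_le_xc`, `rotStripBR_le_iSup` — the limit is `≤ x_c` and dominates every finite width;
* **`rotStripBTLimit`** — packaged: `∀ H ≥ 1, ∃ B ≤ x_c, (∀ W, B^{⊥,→}_{H,W} ≤ B) ∧ B^{⊥,→}_{H,W} → B`
  (the input of the lane's K95.3 comparison step).
-/

noncomputable section

open Filter Topology Literature.Probability.LatticeModels Literature.Probability.Percolation

namespace Literature.Probability.RandomPlanarGeometry.SAW

namespace HV

/-- `W ↦ B^{⊥,→}(H, W)` is monotone. [cite: Beaton2014RotatedHoneycomb, §2.2 (B_{T,L} increasing in L)] -/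
theorem rotStripBR_monotone (H : ℕ) : Monotone (fun Wd : ℕ => rotStripBR H Wd) :=
  fun _ _ h => rotStripBR_mono_width h

/-- `B^{⊥,→}(H, W) ≤ x_c` for EVERY `W` once `H ≥ 1` (width `0` via monotonicity into width `1`).
[cite: Beaton2014RotatedHoneycomb, §4 (bounded by the identity)] -/
theorem rotStripBR_le_xc_all {H : ℕ} (hH : 1 ≤ H) (Wd : ℕ) : rotStripBR H Wd ≤ hexCriticalFugacity :=
  (rotStripBR_mono_width (Nat.le_succ Wd)).trans (rotStripBR_le_hexCriticalFugacity hH (Nat.succ_pos Wd))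

/-- The widths' values are bounded above (by `x_c`). [cite: Beaton2014RotatedHoneycomb, §4] -/
theorem rotStripBR_bddAbove {H : ℕ} (hH : 1 ≤ H) : BddAbove (Set.range fun Wd : ℕ => rotStripBR H Wd) :=
  ⟨hexCriticalFugacity, by rintro _ ⟨Wd, rfl⟩; exact rotStripBR_le_xc_all hH Wd⟩

/-- **`B_T(x_c) := lim_{W → ∞} B^{⊥,→}(H, W)` exists** (= `⨆_W B^{⊥,→}(H, W)`) for every `H ≥ 1`.
[cite: Beaton2014RotatedHoneycomb, §4 (B_T(x_c) = lim_L B_{T,L}(x_c))] -/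
theorem tendsto_rotStripBR {H : ℕ} (hH : 1 ≤ H) :
    Tendsto (fun Wd : ℕ => rotStripBR H Wd) atTop (𝓝 (⨆ Wd : ℕ, rotStripBR H Wd)) :=
  tendsto_atTop_ciSup (rotStripBR_monotone H) (rotStripBR_bddAbove hH)

/-- … and the limit is `≤ x_c`. [cite: Beaton2014RotatedHoneycomb, §4] -/
theorem iSup_rotStripBR_le_xc {H : ℕ} (hH : 1 ≤ H) : (⨆ Wd : ℕ, rotStripBR H Wd) ≤ hexCriticalFugacity :=
  ciSup_le fun Wd => rotStripBR_le_xc_all hH Wd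

/-- … and every finite-width value is below the limit. [cite: Beaton2014RotatedHoneycomb, §4] -/
theorem rotStripBR_le_iSup {H : ℕ} (hH : 1 ≤ H) (Wd : ℕ) : rotStripBR H Wd ≤ ⨆ Wd : ℕ, rotStripBR H Wd :=
  le_ciSup (rotStripBR_bddAbove hH) Wd

/-- **B_T LIMIT** (K95.3 input): for every `H ≥ 1` there is `B ≤ x_c` with `B^{⊥,→}(H, W) ≤ B` for all `W` and
`B^{⊥,→}(H, W) → B` as `W → ∞`. [cite: Beaton2014RotatedHoneycomb, §4 (B_T(x_c) = lim_L B_{T,L}(x_c) ≤ x_c)] -/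
theorem rotStripBTLimit {H : ℕ} (hH : 1 ≤ H) : ∃ B : ℝ, B ≤ hexCriticalFugacity ∧
    (∀ Wd : ℕ, rotStripBR H Wd ≤ B) ∧ Tendsto (fun Wd : ℕ => rotStripBR H Wd) atTop (𝓝 B) :=
  ⟨_, iSup_rotStripBR_le_xc hH, rotStripBR_le_iSup hH, tendsto_rotStripBR hH⟩

end HV

end Literature.Probability.RandomPlanarGeometry.SAW

end
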